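import Literature.NumberTheory.LFunctions.ChebyshevHalfLineBiasCharExplicitFormula
import Literature.NumberTheory.LFunctions.GeneralizedRH
import HarnessLib

/-!
# GRH-CONDITIONAL asymptotics inside a GRH-EQUIVALENT criterion (Suzuki 2025, Thm 8 (4.2) «if»), the IMPRIMITIVE case, PROVED — «nothing here bears on the truth of RH»
# `f_χ(x) = −(L'/L)(½, χ) log x + O(1)` and the Riesz limit (4.2) under GRH, for EVERY non-principal `χ` with `L(½, χ) ≠ 0`

LINE 1 — LABEL: GRH-CONDITIONAL asymptotic (the «if» half of clause (a) of a GRH criterion), PROVED by reduction to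
the tree's primitive case (`ChebyshevHalfLineBiasCharExplicitFormula.lean`, `exists_norm_halfLineSum_add_le_of_GRH`,
whose docstring lists «the imprimitive case of (4.2) ⟸ GRH» as `TODO(general form)` — closed here). bears_on:
LADDER-RH COLUMN 1 SCREW (S-C, criterion rung: Suzuki's Thm 8 second half (4.2), typed as clause (a) of the named fact
`Suzuki2025Chebyshev_thm8_limits` for ALL non-principal `χ`; and Thm 6 (ii)–(iii), which sum (4.2) over the characters
mod `q`, most of them imprimitive). WHAT THIS IS NOT: not a route, not progress toward RH or GRH — under GRH it computes
a limit; nothing here bears on the truth of RH.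

M. Suzuki, *On variants of Chebyshev's conjecture*, Ramanujan J. **68** (2025), no. 4, art. 95 = arXiv:2411.07436
[`Suzuki2025Chebyshev`; PUBLISHED, refereed], §4.1 **Theorem 8, second half**, AS PRINTED: «Let `χ` be a non-principal
Dirichlet character of modulo `q` … Suppose that `L(1/2) ≠ 0`. Then, we have
`lim_{x→∞} Σ_{n ≤ x} Λ(n)χ(n) n^{-1/2}(1 − log n/log x) = −(L'/L)(1/2)` (4.2) if and only if the GRH for `L(s, χ)`
holds.» The printed proof of «if» is (4.5), `f_χ(x) = −(L'/L)(½) log x − Σ_ρ x^{ρ−1/2}/(ρ−1/2)² − (L'/L)'(½) − Σ_k …`,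
with «`ρ` over the non-trivial zeros of `L(s, χ*)`» and `κ* = κ(χ*)` — i.e. the paper silently writes the explicit
formula of the INDUCING PRIMITIVE character `χ*`; for an imprimitive `χ` the two sides differ by the prime powers
`p^k`, `p ∣ q`, which this file accounts for:

* `halfLineSum_eq_sub`: `f_χ(x) = f_{χ*}(x) − Σ_{n ≤ x, (n,q) > 1} Λ(n)χ*(n) n^{-1/2} log(x/n)`;
* `sum_not_coprime_eq`: the correction is `Σ_{p ∣ q} Σ_{1 ≤ k ≤ log_p x} log p · r_p^k (log x − k log p)` with
  `r_p = χ*(p)/√p` (`‖r_p‖ ≤ 1/√2`);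
* `norm_inner_sub_le`: for each `p`, `‖Σ_{k ≤ log_p x} log p · r_p^k (log x − k log p) − log x · log p · r_p/(1 − r_p)‖
  ≤ 8 log p + 12 log²p` (two finite geometric identities, `(1−r)Σ_{k=1}^K r^k = r − r^{K+1}` and
  `(1−ρ)² Σ_{k=1}^K kρ^k ≤ ρ`, and `p^{K+1} > x`);
* `logDeriv_LFunction_eq`: `(L'/L)(½, χ) = (L'/L)(½, χ*) + Σ_{p ∣ q} log p · r_p/(1 − r_p)`, the logarithmic derivative at
  `½` of Mathlib's `L(s, χ) = L(s, χ*) Π_{p ∣ q}(1 − χ*(p)p^{-s})` (`DirichletCharacter.LFunction_changeLevel`);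
* hence `exists_norm_halfLineSum_add_le_of_GRH'` — **GRH ⟹ `‖f_χ(x) + (L'/L)(½, χ) log x‖ ≤ B`, `x > 1`, for every
  `χ ≠ χ₀` with `L(½, χ) ≠ 0`** — and `tendsto_rieszMean_of_GRH'` — **GRH ⟹ (4.2)** with the sum and the limit
  `−logDeriv χ.LFunction (1/2)` exactly as typed in `Suzuki2025Chebyshev_thm8_limits` (a) (GRH and `L(½) ≠ 0` pass to
  `χ*` by the tree's `riemannHypothesis_iff_primitiveCharacter_holds` / `LFunction_eq_zero_iff_primitiveCharacter`).

Not proved here: the converse (4.2) ⟹ GRH (rh-lit-frontier-2, `ChebyshevHalfLineBiasThm8RieszProofs.lean`), clause (b)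
(the sign of `Re (L'/L)(½, χ)`, (4.6)), clause (c) (the order-`m` version (4.2')). GRH-CONDITIONAL clause of a
GRH-EQUIVALENT criterion; nothing in this file is, or is worded as, progress toward RH or GRH. Theorems only
(D-0014/D-0026): no named facts; one glue definition (`eulerRatio`).

## References
* [Suzuki2025Chebyshev] M. Suzuki, Ramanujan J. 68 (2025) 95 = arXiv:2411.07436: §4.1 Thm 8 ((4.2) ⟸ GRH), (4.5).
* [DavenportMNT1980] H. Davenport, *Multiplicative Number Theory*, 2nd ed., ch. 5 (2)–(3):
  `L(s, χ) = L(s, χ*) Π_{p ∣ q}(1 − χ*(p) p^{-s})` — Mathlib `DirichletCharacter.LFunction_changeLevel`.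
-/

noncomputable section

open Filter Topology Set ArithmeticFunction
open scoped Real

namespace Literature.NumberTheory.LFunctions

namespace HalfLineRieszImprimitive

open HalfLineRiesz

/-! ## §1 The Euler ratio `r_p = ψ(p)/√p` and two finite geometric sums -/

/-- `r_p(ψ) = ψ(p)/√p`, the ratio of the Euler factor `1 − ψ(p)p^{-s}` at `s = ½`. [cite: DavenportMNT1980, ch. 5 (2)–(3)] -/
def eulerRatio {N : ℕ} (ψ : DirichletCharacter ℂ N) (p : ℕ) : ℂ := ψ p / (Real.sqrt p : ℂ)

/-- `‖r_p‖ ≤ 1/√p`. [folklore] -/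
private theorem norm_eulerRatio_le {N : ℕ} (ψ : DirichletCharacter ℂ N) {p : ℕ} (hp : p.Prime) :
    ‖eulerRatio ψ p‖ ≤ (Real.sqrt p)⁻¹ := by
  have hsp : 0 < Real.sqrt p := Real.sqrt_pos.2 (by exact_mod_cast hp.pos)
  rw [eulerRatio, norm_div, Complex.norm_real, Real.norm_eq_abs, abs_of_pos hsp, div_eq_mul_inv]
  calc ‖ψ p‖ * (Real.sqrt p)⁻¹ ≤ 1 * (Real.sqrt p)⁻¹ :=
        mul_le_mul_of_nonneg_right (ψ.norm_le_one _) (inv_nonneg.2 hsp.le)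
    _ = (Real.sqrt p)⁻¹ := one_mul _

/-- `1/√p ≤ 3/4` for a prime `p` (as `√2 ≥ 4/3`). [folklore] -/
private theorem inv_sqrt_le {p : ℕ} (hp : p.Prime) : (Real.sqrt p)⁻¹ ≤ 3 / 4 := by
  have hp0 : (0 : ℝ) ≤ p := Nat.cast_nonneg _
  have h43 : (4 / 3 : ℝ) ≤ Real.sqrt p := by
    rw [Real.le_sqrt (by norm_num) hp0]
    have h2 : (2 : ℝ) ≤ p := by exact_mod_cast hp.two_le
    nlinarith
  calc (Real.sqrt p)⁻¹ ≤ (4 / 3 : ℝ)⁻¹ := inv_anti₀ (by norm_num) h43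
    _ = 3 / 4 := by norm_num

/-- `(1 − r) Σ_{k=1}^K r^k = r − r^{K+1}`. [folklore] -/
private theorem geom_Icc (r : ℂ) (K : ℕ) :
    (1 - r) * ∑ k ∈ Finset.Icc 1 K, r ^ k = r - r ^ (K + 1) := by
  induction K with
  | zero => simp
  | succ K ih =>
      rw [Finset.sum_Icc_succ_top (by omega), mul_add, ih]
      ring

/-- `(1 − ρ)² Σ_{k=1}^K k ρ^k = ρ − (K+1)ρ^{K+1} + Kρ^{K+2}`. [folklore] -/
private theorem arith_geom_Icc (ρ : ℝ) (K : ℕ) :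
    (1 - ρ) ^ 2 * ∑ k ∈ Finset.Icc 1 K, (k : ℝ) * ρ ^ k = ρ - (K + 1) * ρ ^ (K + 1) + K * ρ ^ (K + 2) := by
  induction K with
  | zero => simp
  | succ K ih =>
      rw [Finset.sum_Icc_succ_top (by omega), mul_add, ih]
      push_cast
      ring

/-- `Σ_{k=1}^K k ρ^k ≤ 12` for `0 ≤ ρ ≤ 3/4`. [folklore] -/
private theorem arith_geom_le {ρ : ℝ} (hρ0 : 0 ≤ ρ) (hρ : ρ ≤ 3 / 4) (K : ℕ) :
    ∑ k ∈ Finset.Icc 1 K, (k : ℝ) * ρ ^ k ≤ 12 := by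
  have hid := arith_geom_Icc ρ K
  have htail : 0 ≤ (K + 1) * ρ ^ (K + 1) - K * ρ ^ (K + 2) := by
    have h1 : (K : ℝ) * ρ ^ (K + 2) ≤ (K + 1) * ρ ^ (K + 1) := by
      rw [pow_succ ρ (K + 1)]
      have hpow : 0 ≤ ρ ^ (K + 1) := pow_nonneg hρ0 _
      have hK : (0 : ℝ) ≤ K := Nat.cast_nonneg _
      nlinarith [mul_nonneg hK hpow]
    linarith
  have hq : (1 / 16 : ℝ) ≤ (1 - ρ) ^ 2 := by nlinarith
  have hS0 : 0 ≤ ∑ k ∈ Finset.Icc 1 K, (k : ℝ) * ρ ^ k :=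
    Finset.sum_nonneg fun k _ ↦ mul_nonneg (Nat.cast_nonneg _) (pow_nonneg hρ0 _)
  nlinarith

/-! ## §2 The logarithmic derivative of `L(s, χ) = L(s, χ*) Π_{p ∣ q}(1 − χ*(p)p^{-s})` at `s = ½` -/

/-- The Euler factor `s ↦ 1 − ψ(p)p^{-s}` has derivative `ψ(p) log p · p^{-s}`. [folklore] -/
private theorem hasDerivAt_eulerFactor {N : ℕ} (ψ : DirichletCharacter ℂ N) {p : ℕ} (hp : p.Prime) (s : ℂ) :
    HasDerivAt (fun s : ℂ ↦ 1 - ψ p * (p : ℂ) ^ (-s)) (ψ p * Real.log p * (p : ℂ) ^ (-s)) s := by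
  have hp0 : (p : ℂ) ≠ 0 := by exact_mod_cast hp.ne_zero
  have h1 : HasDerivAt (fun s : ℂ ↦ (p : ℂ) ^ (-s)) ((p : ℂ) ^ (-s) * Complex.log p * (-1)) s :=
    ((hasDerivAt_id s).neg).const_cpow (Or.inl hp0)
  have h2 := (h1.const_mul (ψ p)).const_sub 1
  refine h2.congr_deriv ?_
  rw [Complex.natCast_log]
  ring

/-- `p^{-1/2} = 1/√p` in `ℂ`. [folklore] -/
private theorem natCast_cpow_neg_half (p : ℕ) :
    (p : ℂ) ^ (-(1 / 2 : ℂ)) = (((Real.sqrt p)⁻¹ : ℝ) : ℂ) := by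
  have hp0 : (0 : ℝ) ≤ p := Nat.cast_nonneg _
  rw [show (-(1 / 2 : ℂ)) = ((-(1 / 2) : ℝ) : ℂ) by push_cast; ring, ← Complex.ofReal_natCast,
    ← Complex.ofReal_cpow hp0, Real.rpow_neg hp0, ← Real.sqrt_eq_rpow]

/-- The Euler factor at `½` is `1 − r_p ≠ 0`. [folklore] -/
private theorem eulerFactor_half_eq {N : ℕ} (ψ : DirichletCharacter ℂ N) (p : ℕ) :
    1 - ψ p * (p : ℂ) ^ (-(1 / 2 : ℂ)) = 1 - eulerRatio ψ p := by
  rw [natCast_cpow_neg_half p, eulerRatio, Complex.ofReal_inv, div_eq_mul_inv]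

/-- `1 − r_p ≠ 0` (`‖r_p‖ ≤ 3/4`). [folklore] -/
private theorem one_sub_eulerRatio_ne_zero {N : ℕ} (ψ : DirichletCharacter ℂ N) {p : ℕ} (hp : p.Prime) :
    1 - eulerRatio ψ p ≠ 0 := by
  intro h
  have h1 : ‖eulerRatio ψ p‖ = 1 := by rw [← (sub_eq_zero.1 h), norm_one]
  have h2 := le_trans (norm_eulerRatio_le ψ hp) (inv_sqrt_le hp)
  rw [h1] at h2
  norm_num at h2

/-- `logDeriv (1 − ψ(p)p^{-s}) (½) = log p · r_p/(1 − r_p)`. [cite: DavenportMNT1980, ch. 5 (2)–(3)] -/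
theorem logDeriv_eulerFactor {N : ℕ} (ψ : DirichletCharacter ℂ N) {p : ℕ} (hp : p.Prime) :
    logDeriv (fun s : ℂ ↦ 1 - ψ p * (p : ℂ) ^ (-s)) (1 / 2) =
      Real.log p * eulerRatio ψ p / (1 - eulerRatio ψ p) := by
  rw [logDeriv_apply, (hasDerivAt_eulerFactor ψ hp _).deriv, eulerFactor_half_eq ψ p,
    natCast_cpow_neg_half p, eulerRatio, Complex.ofReal_inv]
  ring

variable {q : ℕ} [NeZero q]

/-- **`(L'/L)(½, χ) = (L'/L)(½, χ*) + Σ_{p ∣ q} log p · r_p/(1 − r_p)`** for a non-principal `χ` mod `q` with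
`L(½, χ*) ≠ 0`, `χ*` its inducing primitive character, `r_p = χ*(p)/√p`: the logarithmic derivative at `½` of
`L(s, χ) = L(s, χ*) Π_{p ∣ q}(1 − χ*(p)p^{-s})`. [cite: DavenportMNT1980, ch. 5 (2)–(3)] -/
theorem logDeriv_LFunction_eq (χ : DirichletCharacter ℂ q) (hχ : χ ≠ 1)
    (hhalf : haveI : NeZero χ.conductor := ⟨χ.conductor_ne_zero⟩; χ.primitiveCharacter.LFunction (1 / 2) ≠ 0) :
    haveI : NeZero χ.conductor := ⟨χ.conductor_ne_zero⟩
    logDeriv χ.LFunction (1 / 2) = logDeriv χ.primitiveCharacter.LFunction (1 / 2) +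
      ∑ p ∈ q.primeFactors,
        Real.log p * eulerRatio χ.primitiveCharacter p / (1 - eulerRatio χ.primitiveCharacter p) := by
  haveI : NeZero χ.conductor := ⟨χ.conductor_ne_zero⟩
  set ψ := χ.primitiveCharacter with hψ
  have hψ1 : ψ ≠ 1 := by
    intro h
    apply hχ
    rw [← DirichletCharacter.changeLevel_primitiveCharacter χ, ← hψ, h, map_one]
  have hfun : χ.LFunction = fun s ↦ ψ.LFunction s * ∏ p ∈ q.primeFactors, (1 - ψ p * (p : ℂ) ^ (-s)) := by
    funext s
    have key := DirichletCharacter.LFunction_changeLevel χ.conductor_dvd_level ψ (s := s) (Or.inl hψ1)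
    rw [hψ, DirichletCharacter.changeLevel_primitiveCharacter] at key
    rw [key]
  have hfac : ∀ p ∈ q.primeFactors, (1 - ψ p * (p : ℂ) ^ (-(1 / 2 : ℂ))) ≠ 0 := fun p hp ↦ by
    rw [eulerFactor_half_eq ψ p]
    exact one_sub_eulerRatio_ne_zero ψ (Nat.prime_of_mem_primeFactors hp)
  have hdfac : ∀ p ∈ q.primeFactors, DifferentiableAt ℂ (fun s : ℂ ↦ 1 - ψ p * (p : ℂ) ^ (-s)) (1 / 2) :=
    fun p hp ↦ (hasDerivAt_eulerFactor ψ (Nat.prime_of_mem_primeFactors hp) _).differentiableAt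
  rw [hfun, logDeriv_mul (g := fun s : ℂ ↦ ∏ p ∈ q.primeFactors, (1 - ψ p * (p : ℂ) ^ (-s))) (1 / 2) hhalf
    (Finset.prod_ne_zero_iff.2 hfac) (ψ.differentiableAt_LFunction _ (Or.inr hψ1))
    (DifferentiableAt.fun_finsetProd hdfac), logDeriv_prod hfac hdfac]
  congr 1
  exact Finset.sum_congr rfl fun p hp ↦ logDeriv_eulerFactor ψ (Nat.prime_of_mem_primeFactors hp)

/-! ## §3 `f_χ = f_{χ*} −` (the prime powers `p^k`, `p ∣ q`) -/

omit [NeZero q] in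
/-- At `n` coprime to `q`, `χ(n) = χ*(n)`; otherwise `χ(n) = 0`. [folklore] -/
private theorem map_natCast_eq (χ : DirichletCharacter ℂ q) (n : ℕ) :
    χ (n : ZMod q) = if n.Coprime q then χ.primitiveCharacter (n : ZMod χ.conductor) else 0 := by
  by_cases hn : n.Coprime q
  · rw [if_pos hn]
    obtain ⟨u, hu⟩ := (ZMod.isUnit_iff_coprime n q).2 hn
    conv_lhs => rw [← DirichletCharacter.changeLevel_primitiveCharacter χ, ← hu]
    rw [DirichletCharacter.changeLevel_eq_cast_of_dvd, hu, ZMod.cast_natCast χ.conductor_dvd_level]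
  · rw [if_neg hn]
    exact MulChar.map_nonunit _ ((ZMod.isUnit_iff_coprime n q).not.2 hn)

omit [NeZero q] in
/-- **`f_χ(x) = f_{χ*}(x) − Σ_{n ≤ x, (n, q) > 1} Λ(n)χ*(n) n^{-1/2} log(x/n)`**. [cite: Suzuki2025Chebyshev, §4.1 (4.5)] -/
theorem halfLineSum_eq_sub (χ : DirichletCharacter ℂ q) (x : ℝ) :
    halfLineSum χ x = halfLineSum χ.primitiveCharacter x -
      ∑ n ∈ (Finset.Icc 1 ⌊x⌋₊).filter (fun n ↦ ¬ n.Coprime q),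
        (Λ n : ℂ) * χ.primitiveCharacter n / (Real.sqrt n : ℂ) * (Real.log (x / n) : ℂ) := by
  rw [halfLineSum, halfLineSum, eq_sub_iff_add_eq]
  conv_rhs => rw [← Finset.sum_filter_add_sum_filter_not (Finset.Icc 1 ⌊x⌋₊) (fun n ↦ n.Coprime q)]
  congr 1
  rw [Finset.sum_filter]
  refine Finset.sum_congr rfl fun n _ ↦ ?_
  rw [map_natCast_eq χ n]
  split_ifs with h
  · rfl
  · simp

/-- `√(y^k) = (√y)^k` for `y ≥ 0`. [folklore] -/
private theorem sqrt_pow_eq {y : ℝ} (hy : 0 ≤ y) (k : ℕ) : Real.sqrt (y ^ k) = Real.sqrt y ^ k := by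
  rw [show y ^ k = (Real.sqrt y ^ k) ^ 2 by rw [← pow_mul, mul_comm, pow_mul, Real.sq_sqrt hy],
    Real.sqrt_sq (pow_nonneg (Real.sqrt_nonneg _) _)]

/-- Equal prime powers have equal primes. [folklore] -/
private theorem prime_eq_of_pow_eq {p p' k k' : ℕ} (hp : p.Prime) (hp' : p'.Prime) (hk : k ≠ 0)
    (h : p ^ k = p' ^ k') : p = p' := by
  have h1 : p ∣ p' ^ k' := h ▸ dvd_pow_self p hk
  exact (Nat.prime_dvd_prime_iff_eq hp hp').1 (hp.dvd_of_dvd_pow h1)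

omit [NeZero q] in
/-- The prime powers `≤ X` not coprime to `q` are the `p^k`, `p ∣ q`, `1 ≤ k ≤ log_p X`. [folklore] -/
private theorem filter_eq_biUnion (hq : q ≠ 0) (X : ℕ) :
    ((Finset.Icc 1 X).filter fun n ↦ ¬ n.Coprime q).filter IsPrimePow =
      q.primeFactors.biUnion fun p ↦ (Finset.Icc 1 (Nat.log p X)).image fun k ↦ p ^ k := by
  ext n
  simp only [Finset.mem_filter, Finset.mem_Icc, Finset.mem_biUnion, Finset.mem_image, Nat.mem_primeFactors]
  constructor
  · rintro ⟨⟨⟨hn1, hnX⟩, hcop⟩, hpp⟩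
    obtain ⟨p, k, hp, hk, rfl⟩ := (isPrimePow_nat_iff _).1 hpp
    have hpq : p ∣ q := by
      by_contra h
      exact hcop (Nat.Coprime.pow_left k (hp.coprime_iff_not_dvd.2 h))
    exact ⟨p, ⟨hp, hpq, hq⟩, k, ⟨hk, Nat.le_log_of_pow_le hp.one_lt hnX⟩, rfl⟩
  · rintro ⟨p, ⟨hp, hpq, -⟩, k, ⟨hk1, hkK⟩, rfl⟩
    have hX : X ≠ 0 := by
      rintro rfl
      rw [Nat.log_zero_right] at hkK
      omega
    have hk0 : k ≠ 0 := by omega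
    refine ⟨⟨⟨Nat.one_le_pow _ _ hp.pos, Nat.pow_le_of_le_log hX hkK⟩, fun hcop ↦ ?_⟩, hp.isPrimePow.pow hk0⟩
    exact (hp.coprime_iff_not_dvd.1 (Nat.Coprime.coprime_dvd_left (dvd_pow_self p hk0) hcop)) hpq

/-- **The correction reindexed**: for `x > 0`,
`Σ_{n ≤ x, (n,q) > 1} Λ(n)ψ(n) n^{-1/2} log(x/n) = Σ_{p ∣ q} Σ_{1 ≤ k ≤ log_p ⌊x⌋} log p · r_p^k (log x − k log p)`.
[cite: Suzuki2025Chebyshev, §4.1 (4.5)] -/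
theorem sum_not_coprime_eq {N : ℕ} (ψ : DirichletCharacter ℂ N) {x : ℝ} (hx : 0 < x) :
    ∑ n ∈ (Finset.Icc 1 ⌊x⌋₊).filter (fun n ↦ ¬ n.Coprime q),
        (Λ n : ℂ) * ψ n / (Real.sqrt n : ℂ) * (Real.log (x / n) : ℂ) =
      ∑ p ∈ q.primeFactors, ∑ k ∈ Finset.Icc 1 (Nat.log p ⌊x⌋₊),
        (Real.log p : ℂ) * eulerRatio ψ p ^ k * ((Real.log x - k * Real.log p : ℝ) : ℂ) := by
  have hq : q ≠ 0 := NeZero.ne q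
  set g : ℕ → ℂ := fun n ↦ (Λ n : ℂ) * ψ n / (Real.sqrt n : ℂ) * (Real.log (x / n) : ℂ) with hg
  have h1 : ∑ n ∈ ((Finset.Icc 1 ⌊x⌋₊).filter fun n ↦ ¬ n.Coprime q).filter IsPrimePow, g n =
      ∑ n ∈ (Finset.Icc 1 ⌊x⌋₊).filter (fun n ↦ ¬ n.Coprime q), g n := by
    refine Finset.sum_filter_of_ne fun n _ hne ↦ ?_
    by_contra h
    apply hne
    rw [hg]
    simp only [vonMangoldt_eq_zero_iff.2 h, Complex.ofReal_zero, zero_mul, zero_div]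
  rw [← h1, filter_eq_biUnion hq, Finset.sum_biUnion]
  · refine Finset.sum_congr rfl fun p hp ↦ ?_
    have hpr := Nat.prime_of_mem_primeFactors hp
    rw [Finset.sum_image fun k _ k' _ h ↦ Nat.pow_right_injective hpr.two_le h]
    refine Finset.sum_congr rfl fun k hk ↦ ?_
    rw [Finset.mem_Icc] at hk
    have hp0 : (0 : ℝ) < p := by exact_mod_cast hpr.pos
    have hlog : Real.log (x / ((p ^ k : ℕ) : ℝ)) = Real.log x - k * Real.log p := by
      rw [Nat.cast_pow, Real.log_div hx.ne' (pow_ne_zero _ hp0.ne'), Real.log_pow]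
    rw [hg]
    simp only
    rw [vonMangoldt_apply_pow (by omega), vonMangoldt_apply_prime hpr, hlog, Nat.cast_pow, Nat.cast_pow,
      map_pow, sqrt_pow_eq hp0.le, eulerRatio, div_pow, Complex.ofReal_pow]
    ring
  · intro p hp p' hp' hne
    simp only [Function.onFun]
    rw [Finset.disjoint_left]
    intro n hn hn'
    rw [Finset.mem_image] at hn hn'
    obtain ⟨k, hk, rfl⟩ := hn
    obtain ⟨k', -, h⟩ := hn'
    rw [Finset.mem_Icc] at hk
    have hpr : (p : ℕ).Prime := Nat.prime_of_mem_primeFactors (Finset.mem_coe.1 hp)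
    have hpr' : (p' : ℕ).Prime := Nat.prime_of_mem_primeFactors (Finset.mem_coe.1 hp')
    exact hne (prime_eq_of_pow_eq hpr hpr' (by omega) h.symm)

/-! ## §4 The per-prime estimate -/

/-- `log x ≤ 2√x` for `x > 0`. [folklore] -/
private theorem log_le_two_mul_sqrt {x : ℝ} (hx : 0 < x) : Real.log x ≤ 2 * Real.sqrt x := by
  have hs : 0 < Real.sqrt x := Real.sqrt_pos.2 hx
  have h1 : Real.log (Real.sqrt x) ≤ Real.sqrt x - 1 := Real.log_le_sub_one_of_pos hs
  rw [Real.log_sqrt hx.le] at h1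
  linarith

/-- **Per-prime estimate**: for a prime `p`, `x ≥ 1`, `K = log_p ⌊x⌋` and `r = r_p(ψ)`,
`‖Σ_{k=1}^K log p · r^k (log x − k log p) − log x · log p · r/(1 − r)‖ ≤ 8 log p + 12 log²p`.
[cite: Suzuki2025Chebyshev, §4.1 (4.5)] -/
theorem norm_inner_sub_le {N : ℕ} (ψ : DirichletCharacter ℂ N) {p : ℕ} (hp : p.Prime) {x : ℝ} (hx : 1 ≤ x) :
    ‖∑ k ∈ Finset.Icc 1 (Nat.log p ⌊x⌋₊),
        (Real.log p : ℂ) * eulerRatio ψ p ^ k * ((Real.log x - k * Real.log p : ℝ) : ℂ) -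
      (Real.log x : ℂ) * (Real.log p * eulerRatio ψ p / (1 - eulerRatio ψ p))‖ ≤
      8 * Real.log p + 12 * Real.log p ^ 2 := by
  set r := eulerRatio ψ p with hr
  set K := Nat.log p ⌊x⌋₊ with hK
  set L : ℝ := Real.log x with hL
  set ℓ : ℝ := Real.log p with hℓ
  have hx0 : 0 < x := by linarith
  have hL0 : 0 ≤ L := Real.log_nonneg hx
  have hℓ0 : 0 ≤ ℓ := Real.log_nonneg (by exact_mod_cast hp.one_lt.le)
  have hρ : ‖r‖ ≤ (Real.sqrt p)⁻¹ := norm_eulerRatio_le ψ hp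
  have hρ34 : ‖r‖ ≤ 3 / 4 := le_trans hρ (inv_sqrt_le hp)
  have h1r : 1 - r ≠ 0 := one_sub_eulerRatio_ne_zero ψ hp
  have h1r' : 1 / 4 ≤ ‖1 - r‖ := by
    have := norm_sub_norm_le (1 : ℂ) r
    rw [norm_one] at this
    linarith
  -- the two geometric sums
  set S1 : ℂ := ∑ k ∈ Finset.Icc 1 K, r ^ k with hS1
  set S2 : ℂ := ∑ k ∈ Finset.Icc 1 K, (k : ℂ) * r ^ k with hS2
  have hsum : ∑ k ∈ Finset.Icc 1 K, (ℓ : ℂ) * r ^ k * ((L - k * ℓ : ℝ) : ℂ) =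
      (ℓ : ℂ) * (L : ℂ) * S1 - (ℓ : ℂ) ^ 2 * S2 := by
    rw [hS1, hS2, Finset.mul_sum, Finset.mul_sum, ← Finset.sum_sub_distrib]
    refine Finset.sum_congr rfl fun k _ ↦ ?_
    push_cast
    ring
  have hS1eq : S1 = (r - r ^ (K + 1)) / (1 - r) := by
    rw [eq_div_iff h1r, mul_comm, hS1, geom_Icc]
  have hmain : ∑ k ∈ Finset.Icc 1 K, (ℓ : ℂ) * r ^ k * ((L - k * ℓ : ℝ) : ℂ) -
      (L : ℂ) * ((ℓ : ℂ) * r / (1 - r)) =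
      -((ℓ : ℂ) * (L : ℂ) * (r ^ (K + 1) / (1 - r))) - (ℓ : ℂ) ^ 2 * S2 := by
    rw [hsum, hS1eq]
    field_simp
    ring
  -- `‖r‖^{K+1} ≤ 1/√x`
  have hpow : ‖r‖ ^ (K + 1) ≤ (Real.sqrt x)⁻¹ := by
    have hsp : 0 < Real.sqrt p := Real.sqrt_pos.2 (by exact_mod_cast hp.pos)
    have hsx : 0 < Real.sqrt x := Real.sqrt_pos.2 hx0
    have hxp : x ≤ (p : ℝ) ^ (K + 1) := by
      have h1 : ⌊x⌋₊ < p ^ (K + 1) := Nat.lt_pow_succ_log_self hp.one_lt _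
      have h2 : x < (⌊x⌋₊ : ℝ) + 1 := Nat.lt_floor_add_one x
      have h3 : ((⌊x⌋₊ : ℕ) : ℝ) + 1 ≤ ((p ^ (K + 1) : ℕ) : ℝ) := by exact_mod_cast h1
      push_cast at h3
      linarith
    calc ‖r‖ ^ (K + 1) ≤ (Real.sqrt p)⁻¹ ^ (K + 1) := pow_le_pow_left₀ (norm_nonneg _) hρ _
      _ = (Real.sqrt ((p : ℝ) ^ (K + 1)))⁻¹ := by rw [sqrt_pow_eq (Nat.cast_nonneg _), inv_pow]
      _ ≤ (Real.sqrt x)⁻¹ := inv_anti₀ hsx (Real.sqrt_le_sqrt hxp)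
  -- `‖S2‖ ≤ 12`
  have hS2le : ‖S2‖ ≤ 12 := by
    calc ‖S2‖ ≤ ∑ k ∈ Finset.Icc 1 K, ‖(k : ℂ) * r ^ k‖ := norm_sum_le _ _
      _ = ∑ k ∈ Finset.Icc 1 K, (k : ℝ) * ‖r‖ ^ k := by
          refine Finset.sum_congr rfl fun k _ ↦ ?_
          rw [norm_mul, norm_pow, Complex.norm_natCast]
      _ ≤ 12 := arith_geom_le (norm_nonneg _) hρ34 K
  have hLs : L * (Real.sqrt x)⁻¹ ≤ 2 := by
    have hsx : 0 < Real.sqrt x := Real.sqrt_pos.2 hx0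
    rw [mul_inv_le_iff₀ hsx]
    exact log_le_two_mul_sqrt hx0
  rw [hmain]
  calc ‖-((ℓ : ℂ) * (L : ℂ) * (r ^ (K + 1) / (1 - r))) - (ℓ : ℂ) ^ 2 * S2‖
      ≤ ‖-((ℓ : ℂ) * (L : ℂ) * (r ^ (K + 1) / (1 - r)))‖ + ‖(ℓ : ℂ) ^ 2 * S2‖ := norm_sub_le _ _
    _ = ℓ * L * (‖r‖ ^ (K + 1) / ‖1 - r‖) + ℓ ^ 2 * ‖S2‖ := by
        rw [norm_neg, norm_mul, norm_mul, norm_div, norm_pow, norm_mul, norm_pow, Complex.norm_real,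
          Complex.norm_real, Real.norm_eq_abs, Real.norm_eq_abs, abs_of_nonneg hℓ0, abs_of_nonneg hL0]
    _ ≤ ℓ * L * ((Real.sqrt x)⁻¹ / (1 / 4)) + ℓ ^ 2 * 12 := by
        gcongr
    _ = 4 * ℓ * (L * (Real.sqrt x)⁻¹) + 12 * ℓ ^ 2 := by ring
    _ ≤ 4 * ℓ * 2 + 12 * ℓ ^ 2 := by gcongr
    _ = 8 * ℓ + 12 * ℓ ^ 2 := by ring

/-! ## §5 Assembly: (4.5) and (4.2) under GRH for every non-principal character -/

/-- **Suzuki 2025, (4.5) under GRH, PROVED for every non-principal character**: for `χ ≠ χ₀` mod `q` with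
`L(½, χ) ≠ 0`, the GRH for `L(s, χ)` (the tree's open-strip `DirichletCharacter.RiemannHypothesis`) gives
`‖f_χ(x) + (L'/L)(½, χ) log x‖ ≤ B` for all `x > 1`. The primitive case is the tree's
`HalfLineRiesz.exists_norm_halfLineSum_add_le_of_GRH`; the prime powers `p^k`, `p ∣ q`, shift the coefficient of `log x`
by exactly `(L'/L)(½, χ) − (L'/L)(½, χ*)` and the constant by `O(1)`. GRH-CONDITIONAL.
[cite: Suzuki2025Chebyshev, §4.1 Thm 8 (proof, (4.5))] -/
theorem exists_norm_halfLineSum_add_le_of_GRH' (χ : DirichletCharacter ℂ q) (hχ : χ ≠ 1)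
    (hhalf : χ.LFunction (1 / 2) ≠ 0) (hGRH : χ.RiemannHypothesis) :
    ∃ B : ℝ, ∀ x : ℝ, 1 < x →
      ‖halfLineSum χ x + (Real.log x : ℂ) * (deriv χ.LFunction (1 / 2) / χ.LFunction (1 / 2))‖ ≤ B := by
  haveI : NeZero χ.conductor := ⟨χ.conductor_ne_zero⟩
  have hN1 : 1 < χ.conductor := by
    have h1 : χ.conductor ≠ 1 := fun h ↦ hχ (DirichletCharacter.eq_one_iff_conductor_eq_one.2 h)
    have h0 : χ.conductor ≠ 0 := χ.conductor_ne_zero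
    omega
  set ψ := χ.primitiveCharacter with hψdef
  have hprim : ψ.IsPrimitive := DirichletCharacter.primitiveCharacter_isPrimitive χ
  have hψGRH : ψ.RiemannHypothesis :=
    (DirichletCharacter.riemannHypothesis_iff_primitiveCharacter_holds χ).1 hGRH
  have hψhalf : ψ.LFunction (1 / 2) ≠ 0 := fun h ↦
    hhalf ((χ.LFunction_eq_zero_iff_primitiveCharacter (s := 1 / 2) (by norm_num) (by norm_num)).2 h)
  obtain ⟨B₀, hB₀⟩ := exists_norm_halfLineSum_add_le_of_GRH hprim hN1 hψhalf hψGRH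
  set C : ℝ := ∑ p ∈ q.primeFactors, (8 * Real.log p + 12 * Real.log p ^ 2) with hC
  refine ⟨B₀ + C, fun x hx ↦ ?_⟩
  have hx0 : 0 < x := by linarith
  have hlogd : deriv χ.LFunction (1 / 2) / χ.LFunction (1 / 2) =
      deriv ψ.LFunction (1 / 2) / ψ.LFunction (1 / 2) +
        ∑ p ∈ q.primeFactors, Real.log p * eulerRatio ψ p / (1 - eulerRatio ψ p) := by
    have h := logDeriv_LFunction_eq χ hχ hψhalf
    rw [logDeriv_apply, logDeriv_apply] at h
    rw [h]
  have hsplit : halfLineSum χ x + (Real.log x : ℂ) * (deriv χ.LFunction (1 / 2) / χ.LFunction (1 / 2)) =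
      (halfLineSum ψ x + (Real.log x : ℂ) * (deriv ψ.LFunction (1 / 2) / ψ.LFunction (1 / 2))) -
        ∑ p ∈ q.primeFactors,
          (∑ k ∈ Finset.Icc 1 (Nat.log p ⌊x⌋₊),
              (Real.log p : ℂ) * eulerRatio ψ p ^ k * ((Real.log x - k * Real.log p : ℝ) : ℂ) -
            (Real.log x : ℂ) * (Real.log p * eulerRatio ψ p / (1 - eulerRatio ψ p))) := by
    rw [halfLineSum_eq_sub χ x, sum_not_coprime_eq ψ hx0, hlogd, mul_add, Finset.mul_sum, Finset.sum_sub_distrib]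
    ring
  rw [hsplit]
  calc ‖(halfLineSum ψ x + (Real.log x : ℂ) * (deriv ψ.LFunction (1 / 2) / ψ.LFunction (1 / 2))) -
        ∑ p ∈ q.primeFactors,
          (∑ k ∈ Finset.Icc 1 (Nat.log p ⌊x⌋₊),
              (Real.log p : ℂ) * eulerRatio ψ p ^ k * ((Real.log x - k * Real.log p : ℝ) : ℂ) -
            (Real.log x : ℂ) * (Real.log p * eulerRatio ψ p / (1 - eulerRatio ψ p)))‖
      ≤ ‖halfLineSum ψ x + (Real.log x : ℂ) * (deriv ψ.LFunction (1 / 2) / ψ.LFunction (1 / 2))‖ +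
        ‖∑ p ∈ q.primeFactors,
          (∑ k ∈ Finset.Icc 1 (Nat.log p ⌊x⌋₊),
              (Real.log p : ℂ) * eulerRatio ψ p ^ k * ((Real.log x - k * Real.log p : ℝ) : ℂ) -
            (Real.log x : ℂ) * (Real.log p * eulerRatio ψ p / (1 - eulerRatio ψ p)))‖ := norm_sub_le _ _
    _ ≤ B₀ + C := by
        gcongr
        · exact hB₀ x hx
        · rw [hC]
          exact le_trans (norm_sum_le _ _) (Finset.sum_le_sum fun p hp ↦
            norm_inner_sub_le ψ (Nat.prime_of_mem_primeFactors hp) hx.le)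

/-- **Suzuki 2025, Thm 8, (4.2), «if» direction, PROVED for every non-principal character** (the imprimitive case of
the tree's `HalfLineRiesz.tendsto_rieszMean_of_GRH`): for `χ ≠ χ₀` mod `q` with `L(½, χ) ≠ 0`, the GRH for `L(s, χ)`
implies `lim_{x→∞} Σ_{n ≤ x} Λ(n)χ(n) n^{-1/2}(1 − log n/log x) = −(L'/L)(½, χ)` — the sum and the limit in the form
typed in clause (a) of `Suzuki2025Chebyshev_thm8_limits` (direction GRH ⟹ (4.2); the converse and clauses (b), (c)
are not proved here). GRH-CONDITIONAL clause of a GRH-EQUIVALENT criterion; nothing here bears on the truth of RH.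
[cite: Suzuki2025Chebyshev, §4.1 Thm 8 ((4.2) ⟸ GRH)] -/
theorem tendsto_rieszMean_of_GRH' (χ : DirichletCharacter ℂ q) (hχ : χ ≠ 1)
    (hhalf : χ.LFunction (1 / 2) ≠ 0) (hGRH : χ.RiemannHypothesis) :
    Tendsto (fun x : ℝ ↦ ∑ n ∈ Finset.Icc 1 ⌊x⌋₊,
        (Λ n : ℂ) * χ (n : ZMod q) / (Real.sqrt n : ℂ) * ((1 - Real.log n / Real.log x : ℝ) : ℂ))
      atTop (𝓝 (-logDeriv χ.LFunction (1 / 2))) := by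
  obtain ⟨B, hB⟩ := exists_norm_halfLineSum_add_le_of_GRH' χ hχ hhalf hGRH
  set D : ℂ := deriv χ.LFunction (1 / 2) / χ.LFunction (1 / 2) with hD
  rw [logDeriv_apply, ← hD]
  rw [← tendsto_sub_nhds_zero_iff]
  have hlim : Tendsto (fun x : ℝ ↦ B * (Real.log x)⁻¹) atTop (𝓝 0) := by
    have h := (tendsto_inv_atTop_zero.comp Real.tendsto_log_atTop).const_mul B
    rw [mul_zero] at h
    exact h
  refine squeeze_zero_norm' ?_ hlim
  filter_upwards [eventually_gt_atTop (1 : ℝ)] with x hx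
  have hlx : 0 < Real.log x := Real.log_pos hx
  rw [rieszMean_eq_halfLineSum_div χ hx]
  have heq : halfLineSum χ x / (Real.log x : ℂ) - -D =
      (halfLineSum χ x + (Real.log x : ℂ) * D) / (Real.log x : ℂ) := by
    have hlxC : (Real.log x : ℂ) ≠ 0 := by exact_mod_cast hlx.ne'
    field_simp
    ring
  rw [heq, norm_div, Complex.norm_real, Real.norm_eq_abs, abs_of_pos hlx, div_eq_mul_inv]
  exact mul_le_mul_of_nonneg_right (hB x hx) (inv_nonneg.2 hlx.le)

end HalfLineRieszImprimitive

end Literature.NumberTheory.LFunctions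

end
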